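import Mathlib
import Summits.KontsevichZagierPeriods.KontsevichZagierPeriods.Theorems.InverseLandauTateFamilyKernelStubWallRemoval
import Summits.KontsevichZagierPeriods.KontsevichZagierPeriods.Theorems.InverseLandauTateFamilyKernelStubQhFaceMoments
import Summits.KontsevichZagierPeriods.KontsevichZagierPeriods.Theorems.InverseLandauTateFamilyKernelStubGpDivision

/-!
# Crux `TateFamilyKernel` (stmt-KontsevichZagierPeriods-9130), line `Sketch`:
# stub `stub_primitiveWalls` (wave 15 — the primitive of the exact face family is regular on
# the band)

Variables: `X 0 = s`, `X 1 = ϖ`, polynomials in `MvPolynomial (Fin 2) ℚ`. Data: the face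
denominators `D_a = 1 - ϖ τ_a(s)`, `D_b = 1 - ϖ τ_b(s)`, their frozen versions `D_a(0,ϖ)`,
`D_b(0,ϖ)`, `D̂ = D_a^k D_b^k D_a(0,ϖ)^k D_b(0,ϖ)^k`, a primitive `N_E/(c(ϖ) D̂)` (`c ∈ ℚ[ϖ] ∖ 0`,
`N_E(0,ϖ) ≡ 0`) of the face integrand `j = N_a/D_a^{k+1} + N_b/D_b^{k+1}` in cross-multiplied form
`(∂_s N_E · cD̂ − N_E · ∂_s(cD̂)) (D_aD_b)^{k+1} = (N_a D_b^{k+1} + N_b D_a^{k+1}) (cD̂)²`,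
non-vanishing of `D_a, D_b` on the band `[0,1] × [0,ϖ₀]` (`ϖ₀ > 0`) and `∫₀¹ j(s,ϖ) ds = 0` for
`ϖ ∈ (0,b₁)`, `0 < b₁ ≤ ϖ₀`. Conclusion: the walls (real roots of `c` in `[0,ϖ₀]`) can be
removed — there are `N_E', c'` with `c' ≠ 0` on `[0,ϖ₀]`, the same identity, and
`N_E'(0,ϖ) ≡ N_E'(1,ϖ) ≡ 0`.

Proof.
* `e(s,ϖ) = ∫₀^s j(σ,ϖ) dσ` (integrand clamped to the band, so that Mathlib's
  `intervalIntegral.continuous_parametric_primitive_of_continuous` applies) is continuous on the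
  plane (`PrimitiveWalls.continuous_primitive_clamp`);
* off the walls (`c(ϖ) ≠ 0`) the slice `s ↦ N_E/(cD̂)` has derivative `j(s,ϖ)` by the quotient rule
  and the identity (`PrimitiveWalls.hasDerivAt_quot`), and vanishes at `s = 0`, so it equals
  `e(s,ϖ)` (`intervalIntegral.integral_eq_sub_of_hasDerivAt`): `e·c·D̂ = N_E`;
* this extends to the whole band by continuity in `ϖ` (`WallRemoval.eqOn_of_mul_aeval`), and
  `stub_wallRemoval` gives `N', c'` with `c'` root-free on `[0,ϖ₀]` and `c'N_E = cN'`;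
* `∂_s` kills `c(ϖ), c'(ϖ)` (`GpDivision.pderiv_zero_scalar`), so `c'∂_sN_E = c∂_sN'`, and
  the identity transfers to `(N', c')` after cancelling `c²` in the domain `ℚ[s,ϖ]`
  (`PrimitiveWalls.identity_transfer`, `PrimitiveWalls.aeval_X_one_ne_zero`);
* `e·c'·D̂ = N'` on the band (continuity again); `e(0,ϖ) = 0` and `e(1,ϖ) = 0` on `(0,b₁)` (the
  vanishing face integrals) give `N'(0,ϖ) = N'(1,ϖ) = 0` on `(0,b₁)`, hence for every real `ϖ`
  (a real polynomial with infinitely many roots vanishes, `PrimitiveWalls.aeval_eq_zero_of_Ioo`).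

Note: in the registered signature the substitution target of `hNE0 : bind₁ ![0, X 1] NE = 0` is
`MvPolynomial ℕ ℚ` (numeral defaulting); it still says `N_E(0,ϖ) ≡ 0`
(`PrimitiveWalls.aeval_zero_left_of_bind₁`).

Mathlib plus the landed sibling files `…StubWallRemoval` (`stub_wallRemoval`, `WallRemoval.*`),
`…StubQhFaceMoments` (`QhFaceMoments.hasDerivAt_aeval_left`, `LinDensity.continuous_vec_two`,
`continuous_aeval_real`) and `…StubGpDivision` (`GpDivision.pderiv_zero_scalar`); no named fact, no
new definition. Helpers live in the sub-namespace `PrimitiveWalls`.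
-/

noncomputable section

open MeasureTheory Set MvPolynomial
open Literature.ModelTheory.ExponentialFields (continuous_aeval_real)

namespace Summit.KontsevichZagierPeriods.InverseLandau.TateFamilyKernel.Descent

namespace PrimitiveWalls

/-- `p(s) = aeval (X 0) p` evaluated at a point `(s, ϖ)` of the plane is `p(s)`. [folklore] -/
theorem aeval_aeval_X_zero (s ϖ : ℝ) (p : Polynomial ℚ) :
    aeval (![s, ϖ] : Fin 2 → ℝ) (Polynomial.aeval (X 0 : MvPolynomial (Fin 2) ℚ) p) =
      Polynomial.aeval s p := by
  rw [← Polynomial.aeval_algHom_apply, aeval_X, Matrix.cons_val_zero]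

/-- Evaluation of a face denominator `1 - ϖ·τ(s)` at `(s, ϖ)`. [folklore] -/
theorem aeval_faceDen (s ϖ : ℝ) (τ : Polynomial ℚ) :
    aeval (![s, ϖ] : Fin 2 → ℝ) (1 - X 1 * Polynomial.aeval (X 0 : MvPolynomial (Fin 2) ℚ) τ) =
      1 - ϖ * Polynomial.aeval s τ := by
  rw [map_sub, map_one, map_mul, aeval_X, aeval_aeval_X_zero, Matrix.cons_val_one,
    Matrix.cons_val_zero]

/-- Evaluation of a frozen face denominator `1 - ϖ·τ(0)` at `(s, ϖ)`. [folklore] -/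
theorem aeval_faceDen_zero (s ϖ : ℝ) (τ : Polynomial ℚ) :
    aeval (![s, ϖ] : Fin 2 → ℝ) (1 - X 1 * C (Polynomial.eval 0 τ)) =
      1 - ϖ * Polynomial.aeval (0 : ℝ) τ := by
  rw [map_sub, map_one, map_mul, aeval_X, aeval_C, Matrix.cons_val_one, Matrix.cons_val_zero,
    Polynomial.aeval_def, Polynomial.eval₂_at_zero, Polynomial.coeff_zero_eq_eval_zero]

/-- `q ↦ q(ϖ) = aeval (X 1) q` is injective: `q(ϖ) ≠ 0` in `ℚ[s, ϖ]` for `q ≠ 0`. [folklore] -/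
theorem aeval_X_one_ne_zero {q : Polynomial ℚ} (hq : q ≠ 0) :
    Polynomial.aeval (X 1 : MvPolynomial (Fin 2) ℚ) q ≠ 0 := by
  intro h
  apply hq
  have hq' := Polynomial.aeval_algHom_apply
    (MvPolynomial.aeval (![0, Polynomial.X] : Fin 2 → Polynomial ℚ))
    (X 1 : MvPolynomial (Fin 2) ℚ) q
  rwa [h, map_zero, aeval_X, Matrix.cons_val_one, Matrix.cons_val_zero,
    Polynomial.aeval_X_left_apply] at hq'

/-- **Transfer of the cross-multiplied identity through `c'·N_E = c·N'`** (abstract form, in a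
domain): if `∂c = ∂c' = 0` (encoded as `∂(cD̂) = c∂D̂`, `∂(c'D̂) = c'∂D̂`, `c'∂N_E = c∂N'`), then
`(∂N_E·cD̂ − N_E·∂(cD̂))·Q = P·(cD̂)²` implies `(∂N'·c'D̂ − N'·∂(c'D̂))·Q = P·(c'D̂)²`
(multiply by `c'²`, substitute, cancel `c²`). [folklore] -/
theorem identity_transfer {R : Type*} [CommRing R] [IsDomain R]
    {NE dNE N' dN' cc cc' Dh dDh dG dG' P Q : R} (hcc : cc ≠ 0)
    (hdG : dG = cc * dDh) (hdG' : dG' = cc' * dDh)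
    (hrel : cc' * NE = cc * N') (hdrel : cc' * dNE = cc * dN')
    (hii : (dNE * (cc * Dh) - NE * dG) * Q = P * (cc * Dh) ^ 2) :
    (dN' * (cc' * Dh) - N' * dG') * Q = P * (cc' * Dh) ^ 2 := by
  subst hdG hdG'
  have h : cc ^ 2 * ((dN' * (cc' * Dh) - N' * (cc' * dDh)) * Q) =
      cc ^ 2 * (P * (cc' * Dh) ^ 2) := by
    linear_combination cc' ^ 2 * hii - cc * cc' * Dh * Q * hdrel + Q * cc * cc' * dDh * hrel
  exact mul_left_cancel₀ (pow_ne_zero 2 hcc) h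

/-- The one-variable real polynomial `ϖ ↦ N(s₀, ϖ)`: evaluation of
`aeval ![C s₀, X] N ∈ ℝ[X]`. [folklore] -/
theorem eval_aeval_C_X (s₀ x : ℝ) (N : MvPolynomial (Fin 2) ℚ) :
    (aeval (![Polynomial.C s₀, Polynomial.X] : Fin 2 → Polynomial ℝ) N).eval x =
      aeval (![s₀, x] : Fin 2 → ℝ) N := by
  induction N using MvPolynomial.induction_on with
  | C a => simp
  | add p q hp hq => simp only [map_add, Polynomial.eval_add, hp, hq]
  | mul_X p i hp =>
    simp only [map_mul, Polynomial.eval_mul, hp, aeval_X]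
    congr 1
    refine Fin.cases ?_ (fun j => ?_) i <;> simp

/-- If `ϖ ↦ N(s₀, ϖ)` vanishes on a nondegenerate open interval, it vanishes identically (a real
polynomial with infinitely many roots is zero). [folklore] -/
theorem aeval_eq_zero_of_Ioo {a b : ℝ} (hab : a < b) (s₀ : ℝ) (N : MvPolynomial (Fin 2) ℚ)
    (h : ∀ ϖ ∈ Ioo a b, aeval (![s₀, ϖ] : Fin 2 → ℝ) N = 0) (ϖ : ℝ) :
    aeval (![s₀, ϖ] : Fin 2 → ℝ) N = 0 := by
  have hzero : aeval (![Polynomial.C s₀, Polynomial.X] : Fin 2 → Polynomial ℝ) N = 0 :=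
    Polynomial.eq_zero_of_infinite_isRoot _ ((Ioo_infinite hab).mono fun x hx => by
      rw [mem_setOf_eq, Polynomial.IsRoot.def, eval_aeval_C_X]
      exact h x hx)
  rw [← eval_aeval_C_X, hzero, Polynomial.eval_zero]

/-- `N(0, ϖ)` through the substitution `s ↦ 0, ϖ ↦ X₁`: if `bind₁ ![0, X 1] N = 0` (the target of
the substitution is `MvPolynomial ℕ ℚ`, as elaborated in the registered signature) then
`N(0, ϖ) = 0` for every real `ϖ`. [folklore] -/
theorem aeval_zero_left_of_bind₁ {N : MvPolynomial (Fin 2) ℚ}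
    (h : bind₁ (![0, X 1] : Fin 2 → MvPolynomial ℕ ℚ) N = 0) (ϖ : ℝ) :
    aeval (![0, ϖ] : Fin 2 → ℝ) N = 0 := by
  have h' := congrArg (aeval (fun _ : ℕ => ϖ)) h
  rw [map_zero, aeval_bind₁] at h'
  convert h' using 3
  funext i
  refine Fin.cases ?_ (fun j => ?_) i
  · simp
  · simp [Fin.fin_one_eq_zero j]

/-- **Quotient rule against the cross-multiplied identity.** If
`(∂₀N_E·G − N_E·∂₀G)·(D_aD_b)^{k+1} = (N_aD_b^{k+1} + N_bD_a^{k+1})·G²` in `ℚ[s, ϖ]`, then at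
every real point where `G, D_a, D_b ≠ 0` the slice `x ↦ N_E(x,ϖ)/G(x,ϖ)` has derivative
`N_a/D_a^{k+1} + N_b/D_b^{k+1}`. [folklore] -/
theorem hasDerivAt_quot {NE G Da Db NA NB : MvPolynomial (Fin 2) ℚ} {k : ℕ}
    (hii : (pderiv 0 NE * G - NE * pderiv 0 G) * (Da * Db) ^ (k + 1) =
      (NA * Db ^ (k + 1) + NB * Da ^ (k + 1)) * G ^ 2)
    (ϖ s : ℝ) (hG : aeval (![s, ϖ] : Fin 2 → ℝ) G ≠ 0)
    (hDa : aeval (![s, ϖ] : Fin 2 → ℝ) Da ≠ 0) (hDb : aeval (![s, ϖ] : Fin 2 → ℝ) Db ≠ 0) :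
    HasDerivAt (fun x : ℝ => aeval (![x, ϖ] : Fin 2 → ℝ) NE / aeval (![x, ϖ] : Fin 2 → ℝ) G)
      (aeval (![s, ϖ] : Fin 2 → ℝ) NA / aeval (![s, ϖ] : Fin 2 → ℝ) Da ^ (k + 1) +
        aeval (![s, ϖ] : Fin 2 → ℝ) NB / aeval (![s, ϖ] : Fin 2 → ℝ) Db ^ (k + 1)) s := by
  have h := (QhFaceMoments.hasDerivAt_aeval_left NE ϖ s).div
    (QhFaceMoments.hasDerivAt_aeval_left G ϖ s) hG
  refine h.congr_deriv ?_
  have he := congrArg (aeval (![s, ϖ] : Fin 2 → ℝ)) hii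
  simp only [map_mul, map_sub, map_add, map_pow] at he
  rw [div_add_div _ _ (pow_ne_zero _ hDa) (pow_ne_zero _ hDb),
    div_eq_div_iff (pow_ne_zero _ hG) (mul_ne_zero (pow_ne_zero _ hDa) (pow_ne_zero _ hDb))]
  linear_combination he

/-- **Continuity of the clamped parametric primitive.** For `j` continuous on the band
`[0,1] × [0,ϖ₀]`, the primitive `e(s,ϖ) = ∫₀^s j(σ̂, ϖ̂) dσ` of the clamped integrand (`σ̂, ϖ̂` the
projections of `σ, ϖ` to `[0,1]`, `[0,ϖ₀]`) is continuous on the plane. [folklore] -/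
theorem continuous_primitive_clamp {ϖ₀ : ℝ} (hϖ₀ : 0 ≤ ϖ₀) {j : ℝ × ℝ → ℝ}
    (hj : ContinuousOn j (Icc (0 : ℝ) 1 ×ˢ Icc (0 : ℝ) ϖ₀)) :
    Continuous fun p : ℝ × ℝ => ∫ σ in (0 : ℝ)..p.1,
      j ((projIcc 0 1 zero_le_one σ : ℝ), (projIcc 0 ϖ₀ hϖ₀ p.2 : ℝ)) := by
  have hc : Continuous fun q : ℝ × ℝ =>
      j ((projIcc 0 1 zero_le_one q.2 : ℝ), (projIcc 0 ϖ₀ hϖ₀ q.1 : ℝ)) :=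
    hj.comp_continuous
      ((continuous_subtype_val.comp (continuous_projIcc.comp continuous_snd)).prodMk
        (continuous_subtype_val.comp (continuous_projIcc.comp continuous_fst)))
      fun q => ⟨(projIcc 0 1 zero_le_one q.2).2, (projIcc 0 ϖ₀ hϖ₀ q.1).2⟩
  exact (intervalIntegral.continuous_parametric_primitive_of_continuous
    (f := fun ϖ σ => j ((projIcc 0 1 zero_le_one σ : ℝ), (projIcc 0 ϖ₀ hϖ₀ ϖ : ℝ))) hc).comp
    continuous_swap

end PrimitiveWalls

open PrimitiveWalls in
/-- STUB (wave 15, analysis + wall removal). **The primitive of the exact face family is regular on the band.**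
Given the cross-multiplied identity `∂_s(N_E/(cD̂)) = N_a/D_a^{k+1} + N_b/D_b^{k+1}` with `N_E(0,ϖ) ≡ 0`
(`stub_primitiveAlgebra`), non-vanishing face denominators on `[0,1] × [0,ϖ₀]` (`ϖ₀ > 0`) and vanishing face integrals
`∫₀¹ (N_a/D_a^{k+1} + N_b/D_b^{k+1}) ds = 0` for `ϖ ∈ (0,b₁)`, `b₁ ≤ ϖ₀`: the walls (real roots of `c` in `[0,ϖ₀]`) can be
removed — there are `N_E', c'` with `c' ≠ 0` on `[0,ϖ₀]`, the same identity, and `N_E'(0,ϖ) ≡ N_E'(1,ϖ) ≡ 0`. (The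
continuous function `e(s,ϖ) = ∫₀^s (N_a/D_a^{k+1} + N_b/D_b^{k+1})` equals `N_E/(cD̂)` off the walls by the fundamental
theorem of calculus, so `e·c·D̂ = N_E` on the band by continuity; `stub_wallRemoval`; the new identity follows by
cancelling `c²c'` in the domain `ℚ[s,ϖ]`; `N_E'(1,ϖ) = c'(ϖ)D̂(1,ϖ)e(1,ϖ) = 0` on `(0,b₁)`, hence identically.) [folklore] -/
theorem stub_primitiveWalls (τa τb : Polynomial ℚ) (k : ℕ) (NA NB NE : MvPolynomial (Fin 2) ℚ)
    (c : Polynomial ℚ) (hc : c ≠ 0) (hNE0 : bind₁ ![0, X 1] NE = 0)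
    (hii : (pderiv 0 NE * (Polynomial.aeval (X 1 : MvPolynomial (Fin 2) ℚ) c *
            ((1 - X 1 * Polynomial.aeval (X 0 : MvPolynomial (Fin 2) ℚ) τa) ^ k *
              (1 - X 1 * Polynomial.aeval (X 0 : MvPolynomial (Fin 2) ℚ) τb) ^ k *
              (1 - X 1 * C (Polynomial.eval 0 τa)) ^ k * (1 - X 1 * C (Polynomial.eval 0 τb)) ^ k)) -
          NE * pderiv 0 (Polynomial.aeval (X 1 : MvPolynomial (Fin 2) ℚ) c *
            ((1 - X 1 * Polynomial.aeval (X 0 : MvPolynomial (Fin 2) ℚ) τa) ^ k *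
              (1 - X 1 * Polynomial.aeval (X 0 : MvPolynomial (Fin 2) ℚ) τb) ^ k *
              (1 - X 1 * C (Polynomial.eval 0 τa)) ^ k * (1 - X 1 * C (Polynomial.eval 0 τb)) ^ k))) *
          ((1 - X 1 * Polynomial.aeval (X 0 : MvPolynomial (Fin 2) ℚ) τa) *
            (1 - X 1 * Polynomial.aeval (X 0 : MvPolynomial (Fin 2) ℚ) τb)) ^ (k + 1) =
        (NA * (1 - X 1 * Polynomial.aeval (X 0 : MvPolynomial (Fin 2) ℚ) τb) ^ (k + 1) +
            NB * (1 - X 1 * Polynomial.aeval (X 0 : MvPolynomial (Fin 2) ℚ) τa) ^ (k + 1)) *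
          (Polynomial.aeval (X 1 : MvPolynomial (Fin 2) ℚ) c *
            ((1 - X 1 * Polynomial.aeval (X 0 : MvPolynomial (Fin 2) ℚ) τa) ^ k *
              (1 - X 1 * Polynomial.aeval (X 0 : MvPolynomial (Fin 2) ℚ) τb) ^ k *
              (1 - X 1 * C (Polynomial.eval 0 τa)) ^ k * (1 - X 1 * C (Polynomial.eval 0 τb)) ^ k)) ^ 2)
    (ϖ₀ : ℝ) (hϖ₀ : 0 < ϖ₀)
    (hband : ∀ s ∈ Icc (0 : ℝ) 1, ∀ ϖ ∈ Icc (0 : ℝ) ϖ₀,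
      1 - ϖ * Polynomial.aeval s τa ≠ 0 ∧ 1 - ϖ * Polynomial.aeval s τb ≠ 0)
    (b₁ : ℝ) (hb₁ : 0 < b₁) (hb₁ϖ₀ : b₁ ≤ ϖ₀)
    (hvan : ∀ ϖ ∈ Ioo (0 : ℝ) b₁, ∫ s in (0 : ℝ)..1,
      (aeval (![s, ϖ] : Fin 2 → ℝ) NA / (1 - ϖ * Polynomial.aeval s τa) ^ (k + 1) +
        aeval (![s, ϖ] : Fin 2 → ℝ) NB / (1 - ϖ * Polynomial.aeval s τb) ^ (k + 1)) = 0) :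
    ∃ (NE' : MvPolynomial (Fin 2) ℚ) (c' : Polynomial ℚ),
      (∀ ϖ ∈ Icc (0 : ℝ) ϖ₀, Polynomial.aeval ϖ c' ≠ 0) ∧
      (pderiv 0 NE' * (Polynomial.aeval (X 1 : MvPolynomial (Fin 2) ℚ) c' *
            ((1 - X 1 * Polynomial.aeval (X 0 : MvPolynomial (Fin 2) ℚ) τa) ^ k *
              (1 - X 1 * Polynomial.aeval (X 0 : MvPolynomial (Fin 2) ℚ) τb) ^ k *
              (1 - X 1 * C (Polynomial.eval 0 τa)) ^ k * (1 - X 1 * C (Polynomial.eval 0 τb)) ^ k)) -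
          NE' * pderiv 0 (Polynomial.aeval (X 1 : MvPolynomial (Fin 2) ℚ) c' *
            ((1 - X 1 * Polynomial.aeval (X 0 : MvPolynomial (Fin 2) ℚ) τa) ^ k *
              (1 - X 1 * Polynomial.aeval (X 0 : MvPolynomial (Fin 2) ℚ) τb) ^ k *
              (1 - X 1 * C (Polynomial.eval 0 τa)) ^ k * (1 - X 1 * C (Polynomial.eval 0 τb)) ^ k))) *
          ((1 - X 1 * Polynomial.aeval (X 0 : MvPolynomial (Fin 2) ℚ) τa) *
            (1 - X 1 * Polynomial.aeval (X 0 : MvPolynomial (Fin 2) ℚ) τb)) ^ (k + 1) =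
        (NA * (1 - X 1 * Polynomial.aeval (X 0 : MvPolynomial (Fin 2) ℚ) τb) ^ (k + 1) +
            NB * (1 - X 1 * Polynomial.aeval (X 0 : MvPolynomial (Fin 2) ℚ) τa) ^ (k + 1)) *
          (Polynomial.aeval (X 1 : MvPolynomial (Fin 2) ℚ) c' *
            ((1 - X 1 * Polynomial.aeval (X 0 : MvPolynomial (Fin 2) ℚ) τa) ^ k *
              (1 - X 1 * Polynomial.aeval (X 0 : MvPolynomial (Fin 2) ℚ) τb) ^ k *
              (1 - X 1 * C (Polynomial.eval 0 τa)) ^ k * (1 - X 1 * C (Polynomial.eval 0 τb)) ^ k)) ^ 2 ∧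
      (∀ ϖ : ℝ, aeval (![0, ϖ] : Fin 2 → ℝ) NE' = 0) ∧ (∀ ϖ : ℝ, aeval (![1, ϖ] : Fin 2 → ℝ) NE' = 0) := by
  -- names for the denominators (`X 0 = s`, `X 1 = ϖ`)
  set Da : MvPolynomial (Fin 2) ℚ := 1 - X 1 * Polynomial.aeval (X 0 : MvPolynomial (Fin 2) ℚ) τa
    with hDa
  set Db : MvPolynomial (Fin 2) ℚ := 1 - X 1 * Polynomial.aeval (X 0 : MvPolynomial (Fin 2) ℚ) τb
    with hDb
  set Dh : MvPolynomial (Fin 2) ℚ := Da ^ k * Db ^ k * (1 - X 1 * C (Polynomial.eval 0 τa)) ^ k *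
    (1 - X 1 * C (Polynomial.eval 0 τb)) ^ k with hDh
  -- real evaluations of the denominators; `D̂ ≠ 0` on the band
  have hDa_ev : ∀ s ϖ : ℝ, aeval (![s, ϖ] : Fin 2 → ℝ) Da = 1 - ϖ * Polynomial.aeval s τa :=
    fun s ϖ => aeval_faceDen s ϖ τa
  have hDb_ev : ∀ s ϖ : ℝ, aeval (![s, ϖ] : Fin 2 → ℝ) Db = 1 - ϖ * Polynomial.aeval s τb :=
    fun s ϖ => aeval_faceDen s ϖ τb
  have hDh_ne : ∀ s ∈ Icc (0 : ℝ) 1, ∀ ϖ ∈ Icc (0 : ℝ) ϖ₀,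
      aeval (![s, ϖ] : Fin 2 → ℝ) Dh ≠ 0 := by
    intro s hs ϖ hϖ
    have h0 := hband 0 (left_mem_Icc.2 zero_le_one) ϖ hϖ
    have h1 := hband s hs ϖ hϖ
    simp only [hDh, map_mul, map_pow, hDa_ev, hDb_ev, aeval_faceDen_zero]
    exact mul_ne_zero (mul_ne_zero (mul_ne_zero (pow_ne_zero _ h1.1) (pow_ne_zero _ h1.2))
      (pow_ne_zero _ h0.1)) (pow_ne_zero _ h0.2)
  -- the face integrand `j`, continuous on the band, and its clamped primitive `e`
  set j : ℝ × ℝ → ℝ := fun q =>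
    aeval (![q.1, q.2] : Fin 2 → ℝ) NA / (1 - q.2 * Polynomial.aeval q.1 τa) ^ (k + 1) +
      aeval (![q.1, q.2] : Fin 2 → ℝ) NB / (1 - q.2 * Polynomial.aeval q.1 τb) ^ (k + 1) with hj
  have hjc : ContinuousOn j (Icc (0 : ℝ) 1 ×ˢ Icc (0 : ℝ) ϖ₀) := by
    have hN : ∀ N : MvPolynomial (Fin 2) ℚ,
        Continuous fun q : ℝ × ℝ => aeval (![q.1, q.2] : Fin 2 → ℝ) N := fun N =>
      (continuous_aeval_real N).comp (LinDensity.continuous_vec_two continuous_fst continuous_snd)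
    have hD : ∀ τ : Polynomial ℚ,
        Continuous fun q : ℝ × ℝ => (1 - q.2 * Polynomial.aeval q.1 τ) ^ (k + 1) := fun τ =>
      (continuous_const.sub (continuous_snd.mul
        ((Polynomial.continuous_aeval τ).comp continuous_fst))).pow _
    refine ((hN NA).continuousOn.div (hD τa).continuousOn fun q hq => ?_).add
      ((hN NB).continuousOn.div (hD τb).continuousOn fun q hq => ?_)
    · exact pow_ne_zero _ (hband q.1 hq.1 q.2 hq.2).1
    · exact pow_ne_zero _ (hband q.1 hq.1 q.2 hq.2).2
  set e : ℝ × ℝ → ℝ := fun p => ∫ σ in (0 : ℝ)..p.1,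
    j ((projIcc 0 1 zero_le_one σ : ℝ), (projIcc 0 ϖ₀ hϖ₀.le p.2 : ℝ)) with he_def
  have he : Continuous e := continuous_primitive_clamp hϖ₀.le hjc
  -- on the band the clamps are inactive
  have he_eq : ∀ s ∈ Icc (0 : ℝ) 1, ∀ ϖ ∈ Icc (0 : ℝ) ϖ₀,
      e (s, ϖ) = ∫ σ in (0 : ℝ)..s, j (σ, ϖ) := by
    intro s hs ϖ hϖ
    refine intervalIntegral.integral_congr fun σ hσ => ?_
    rw [uIcc_of_le hs.1] at hσ
    simp only [projIcc_of_mem _ ⟨hσ.1, hσ.2.trans hs.2⟩, projIcc_of_mem _ hϖ]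
  -- `N_E(0, ϖ) = 0`
  have hNE0' : ∀ ϖ : ℝ, aeval (![0, ϖ] : Fin 2 → ℝ) NE = 0 := aeval_zero_left_of_bind₁ hNE0
  -- off the walls, `e·c·D̂ = N_E` by the fundamental theorem of calculus for `N_E/(cD̂)`
  have hFTC : ∀ ϖ ∈ Icc (0 : ℝ) ϖ₀, Polynomial.aeval ϖ c ≠ 0 → ∀ s ∈ Icc (0 : ℝ) 1,
      e (s, ϖ) * Polynomial.aeval ϖ c * aeval (![s, ϖ] : Fin 2 → ℝ) Dh =
        aeval (![s, ϖ] : Fin 2 → ℝ) NE := by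
    intro ϖ hϖ hcϖ s hs
    have hG : ∀ x : ℝ, aeval (![x, ϖ] : Fin 2 → ℝ)
        (Polynomial.aeval (X 1 : MvPolynomial (Fin 2) ℚ) c * Dh) =
          Polynomial.aeval ϖ c * aeval (![x, ϖ] : Fin 2 → ℝ) Dh := fun x => by
      rw [map_mul, WallRemoval.aeval_aeval_X_one]
    have hderiv : ∀ x ∈ uIcc (0 : ℝ) s, HasDerivAt (fun u : ℝ => aeval (![u, ϖ] : Fin 2 → ℝ) NE /
        aeval (![u, ϖ] : Fin 2 → ℝ) (Polynomial.aeval (X 1 : MvPolynomial (Fin 2) ℚ) c * Dh))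
        (j (x, ϖ)) x := by
      intro x hx
      rw [uIcc_of_le hs.1] at hx
      have hx1 : x ∈ Icc (0 : ℝ) 1 := ⟨hx.1, hx.2.trans hs.2⟩
      have h := hasDerivAt_quot hii ϖ x (by rw [hG]; exact mul_ne_zero hcϖ (hDh_ne x hx1 ϖ hϖ))
        (by rw [hDa_ev]; exact (hband x hx1 ϖ hϖ).1) (by rw [hDb_ev]; exact (hband x hx1 ϖ hϖ).2)
      rwa [hDa_ev, hDb_ev] at h
    have hint : IntervalIntegrable (fun x => j (x, ϖ)) volume 0 s := by
      refine (hjc.comp (continuous_id.prodMk continuous_const).continuousOn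
        fun x hx => ?_).intervalIntegrable
      rw [uIcc_of_le hs.1] at hx
      exact ⟨⟨hx.1, hx.2.trans hs.2⟩, hϖ⟩
    have hftc := intervalIntegral.integral_eq_sub_of_hasDerivAt hderiv hint
    rw [← he_eq s hs ϖ hϖ, hNE0', zero_div, sub_zero, hG] at hftc
    rw [hftc, mul_assoc, div_mul_cancel₀ _ (mul_ne_zero hcϖ (hDh_ne s hs ϖ hϖ))]
  -- on the whole band, by continuity across the (finitely many) walls
  have heq : ∀ s ∈ Icc (0 : ℝ) 1, ∀ ϖ ∈ Icc (0 : ℝ) ϖ₀,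
      e (s, ϖ) * Polynomial.aeval ϖ c * aeval (![s, ϖ] : Fin 2 → ℝ) Dh =
        aeval (![s, ϖ] : Fin 2 → ℝ) NE := by
    intro s hs
    have hes : Continuous fun ϖ : ℝ => e (s, ϖ) := he.comp (continuous_const.prodMk continuous_id)
    refine WallRemoval.eqOn_of_mul_aeval hϖ₀ hc
      ((hes.mul (Polynomial.continuous_aeval (A := ℝ) c)).mul
        (WallRemoval.continuous_aeval_right s Dh)).continuousOn
      (WallRemoval.continuous_aeval_right s NE).continuousOn fun ϖ hϖ => ?_
    by_cases hcϖ : Polynomial.aeval ϖ c = 0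
    · rw [hcϖ, mul_zero, mul_zero]
    · rw [hFTC ϖ hϖ hcϖ s hs]
  -- wall removal
  obtain ⟨N', c', hc', hrel⟩ := stub_wallRemoval ϖ₀ hϖ₀ NE Dh c hc e he.continuousOn heq
  -- `∂_s` kills `c(ϖ)` and `c'(ϖ)`
  have hd : ∀ q : Polynomial ℚ, pderiv 0 (Polynomial.aeval (X 1 : MvPolynomial (Fin 2) ℚ) q * Dh) =
      Polynomial.aeval (X 1 : MvPolynomial (Fin 2) ℚ) q * pderiv 0 Dh := fun q => by
    rw [pderiv_mul, GpDivision.pderiv_zero_scalar, zero_mul, zero_add]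
  have hdrel : Polynomial.aeval (X 1 : MvPolynomial (Fin 2) ℚ) c' * pderiv 0 NE =
      Polynomial.aeval (X 1 : MvPolynomial (Fin 2) ℚ) c * pderiv 0 N' := by
    have h := congrArg (pderiv 0) hrel
    rwa [pderiv_mul, pderiv_mul, GpDivision.pderiv_zero_scalar, GpDivision.pderiv_zero_scalar,
      zero_mul, zero_add, zero_mul, zero_add] at h
  -- the relation `e·c'·D̂ = N'` on the band
  have heq' : ∀ s ∈ Icc (0 : ℝ) 1, ∀ ϖ ∈ Icc (0 : ℝ) ϖ₀,
      e (s, ϖ) * Polynomial.aeval ϖ c' * aeval (![s, ϖ] : Fin 2 → ℝ) Dh =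
        aeval (![s, ϖ] : Fin 2 → ℝ) N' := by
    intro s hs
    have hes : Continuous fun ϖ : ℝ => e (s, ϖ) := he.comp (continuous_const.prodMk continuous_id)
    refine WallRemoval.eqOn_of_mul_aeval hϖ₀ hc
      ((hes.mul (Polynomial.continuous_aeval (A := ℝ) c')).mul
        (WallRemoval.continuous_aeval_right s Dh)).continuousOn
      (WallRemoval.continuous_aeval_right s N').continuousOn fun ϖ hϖ => ?_
    have h1 := heq s hs ϖ hϖ
    have h2 := congrArg (aeval (![s, ϖ] : Fin 2 → ℝ)) hrel
    simp only [map_mul, WallRemoval.aeval_aeval_X_one] at h2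
    linear_combination Polynomial.aeval ϖ c' * h1 + h2
  refine ⟨N', c', hc', identity_transfer (aeval_X_one_ne_zero hc) (hd c) (hd c') hrel hdrel hii,
    fun ϖ => ?_, fun ϖ => ?_⟩
  · -- `N'(0, ϖ) = 0`: `e(0, ϖ) = 0` on the band, then a polynomial identity in `ϖ`
    refine aeval_eq_zero_of_Ioo hb₁ 0 N' (fun ϖ hϖ => ?_) ϖ
    have hϖ' : ϖ ∈ Icc (0 : ℝ) ϖ₀ := ⟨hϖ.1.le, hϖ.2.le.trans hb₁ϖ₀⟩
    have h := heq' 0 (left_mem_Icc.2 zero_le_one) ϖ hϖ'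
    rwa [show e (0, ϖ) = 0 from intervalIntegral.integral_same, zero_mul, zero_mul, eq_comm] at h
  · -- `N'(1, ϖ) = 0`: `e(1, ϖ) = 0` on `(0, b₁)` by the vanishing of the face integrals
    refine aeval_eq_zero_of_Ioo hb₁ 1 N' (fun ϖ hϖ => ?_) ϖ
    have hϖ' : ϖ ∈ Icc (0 : ℝ) ϖ₀ := ⟨hϖ.1.le, hϖ.2.le.trans hb₁ϖ₀⟩
    have h := heq' 1 (right_mem_Icc.2 zero_le_one) ϖ hϖ'
    have he1 : e (1, ϖ) = 0 := by
      rw [he_eq 1 (right_mem_Icc.2 zero_le_one) ϖ hϖ']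
      exact hvan ϖ hϖ
    rwa [he1, zero_mul, zero_mul, eq_comm] at h

end Summit.KontsevichZagierPeriods.InverseLandau.TateFamilyKernel.Descent

end
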